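import Mathlib
import Summits.NavierStokesRegularity.NavierStokesRegularity.Theorems.EulerZoomLiouvillePowerGaugeEulerLiouvilleSelfSimilarOffRateTools
import Summits.NavierStokesRegularity.NavierStokesRegularity.Theorems.EulerZoomLiouvillePowerGaugeEulerLiouvilleSelfSimilarPastSubExtremal
import Summits.NavierStokesRegularity.NavierStokesRegularity.Theorems.EulerZoomLiouvillePowerGaugeEulerLiouvilleSelfSimilarTransfer
import Summits.NavierStokesRegularity.NavierStokesRegularity.Theorems.EulerZoomLiouvillePowerGaugeEulerLiouvillePastFastClock
import Summits.NavierStokesRegularity.NavierStokesRegularity.Theorems.EulerZoomLiouvillePowerGaugeEulerLiouvillePastSlowClock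
import HarnessLib

/-!
# RATE RIGIDITY: an exactly self-similar member of Seregin's `ρ`-class collapses at the CLASS RATE `γ = 1/(2+ρ)` or is trivial
# (crux `EulerZoomLiouville.PowerGaugeEulerLiouville` = stmt-NavierStokesRegularity-19832; line `birth` / line `logtime-breathers`, residue T4 —
# the exponent WINDOW `(γ, ½ − ρ/5]` CLOSES at `T₀ = 0`, weak class, no profile hypothesis)

Route `EulerZoomLiouville` (NavierStokesRegularity); width seat ns-ezl-w4 g2.  Euler's two-parameter scaling admits self-similar collapses
`u(τ, y) = (−τ)^{g−1} W((−τ)^{−g} y)`, `p(τ, y) = (−τ)^{2(g−1)} P((−τ)^{−g} y)` of EVERY rate `g`; the class scaling is `g = γ = 1/(2+ρ)`.  The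
tree kills the FAST rates `g > ½ − ρ/5` and the SLOW rates `g < γ` by the `A`-gauge alone (`PastShape.…pastFastPowerClock` / `…slowPowerClock`,
profile arbitrary); the window `(γ, ½ − ρ/5]` was the open residue T4 of line `logtime-breathers` (its TAME `C²` profiles died in
`…PowerClockTameProfile`, its finite-energy ones for `g < 2/5` in `…PowerClockFiniteEnergy`).  Here the window closes entirely:

> **`OffRate.selfSimilar_ae_eq_zero_of_rate_window`** — crux hypotheses verbatim (`0 < ρ ≤ ½`, weak class) + exact self-similarity of `(u, p)` at a
> rate `g` with `γ < g < ½` ⇒ `u = 0` a.e.; **`OffRate.selfSimilar_ae_eq_zero_of_rate_ne`** — the same for EVERY `g ≠ γ`.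

MECHANISM — Bronzi–Shvydkoy's energy dichotomy read OFF-RATE, by re-plumbing the tree (nothing new is proved analytically).  Put `ρ' = 1/g − 2`; then
`1/(2+ρ') = g`, `0 < ρ' < ρ`, `ρ' < 1` (`OffRate.exponent_facts`), and the lineage's rate-`γ` dictionary is `γ`-GENERAL: `exists_profileGradient_ae`,
`ProfileEquation.weak_profile_equation`, `ProfileEquation.profile_isWeaklyDivFree`, `Past.profile_pressure_poisson_of_distributional` and the profile LOCAL
ENERGY EQUALITY `ProfileEnergy.profile_local_energy_equality` all carry a free exponent, so they apply to the rate-`g` member verbatim and produce the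
`ρ'`-shaped equations.  The LARGE-SCALE profile data in the `ρ'`-shapes — (A₁) `∫_{B_L}|W|² ≲ L^{1−2ρ'}`, (E₁) `∫_{B_L}|G|²_F ≲ L^{1−ρ'}`,
(D₁) `∫_{B_L}|P|^{3/2} ≲ L^{2−2ρ'}` for `L ≥ 1` — come from the `ρ`-gauges read at scales `a ≥ 1` only: (A₁) from the slice `τ = −1` (`u(−1) = W`,
`OffRate.profile_growth_ge_one`, exponent `1 − 2ρ ≤ 1 − 2ρ'`); (E₁), (D₁) from ns-ezl-w1's bricks `Past.profile_gradient_growth_of_gaugeE_past` /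
`Past.profile_pressure_growth_of_gaugeD_past` applied WITH `ρ'` to the gradient and pressure TRUNCATED to `τ < −1`, whose `ρ'`-gauges hold at every
scale (`OffRate.gaugeE_cut` / `gaugeD_cut`: small windows miss the far past, `a^{ρ'} ≤ a^{ρ}` for `a ≥ 1`).  Finally SUB-EXTREMALITY IN THE
`ρ'`-NORMALISATION IS AUTOMATIC: `L^{2ρ'−1}∫_{B_L}|W|² ≤ 2c L^{2(ρ'−ρ)} → 0` precisely because `g > γ ⟺ ρ' < ρ`.  So ns-ezl-w1's large-scale
Bronzi–Shvydkoy dichotomy `EnergySaturation.ae_eq_zero_of_subExtremal_loc (ρ := ρ')` gives `W = 0` a.e., and `Past.ae_eq_zero_of_profile_ae_eq_zero`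
the member.  In words: the natural off-rate energy growth `L^{3−2α} = L^{5−2/g}` of a rate-`g` profile EXCEEDS the `A`-gauge's `L^{1−2ρ}` when
`g > γ`, and the dichotomy leaves only `W = 0`.

* `OffRate.exists_locData` — the `ρ'`-shaped large-scale profile data of a rate-`g` member (`γ < g < ½`);
* `OffRate.selfSimilar_ae_eq_zero_of_rate_window` — `γ < g < ½` ⇒ trivial;
* `OffRate.selfSimilar_ae_eq_zero_of_rate_ne` — `g ≠ γ` ⇒ trivial (slow / window / fast).

WHAT THIS IS NOT: not NS, not E — a stratum of the crux CLASS 19832 on the MODEL lattice, `--supports` stmt-19832.  The CLASS-RATE members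
(`g = γ`: THE ONE STATEMENT and the weak residue) are untouched; power clocks about `T₀ > 0` with slow rates stay in the residue.
[folklore; cf. BronziShvydkoy2015 Thm 1.1; ChaeShvydkoy2013 §1]
-/

noncomputable section

-- flat `Theorems/<Route><Decl>…` files of one crux share the namespace of the crux (tree convention: `Summit.<S>.<S>.…`)
set_option linter.dupNamespace false

open MeasureTheory Set Filter Topology Metric Function TopologicalSpace
open scoped ENNReal NNReal InnerProductSpace RealInnerProductSpace Laplacian

namespace Summit.NavierStokesRegularity.NavierStokesRegularity.Theorems.PowerGaugeEulerLiouville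

open Literature.Analysis Literature.Analysis.FunctionSpaces Literature.Analysis.FluidPDE

namespace OffRate

variable {ρ g : ℝ}
  {u : ℝ → EuclideanSpace ℝ (Fin 3) → EuclideanSpace ℝ (Fin 3)} {p : ℝ → EuclideanSpace ℝ (Fin 3) → ℝ}
  {H : ℝ → EuclideanSpace ℝ (Fin 3) → EuclideanSpace ℝ (Fin 3) →L[ℝ] EuclideanSpace ℝ (Fin 3)} {c : ℝ≥0}
  {W : EuclideanSpace ℝ (Fin 3) → EuclideanSpace ℝ (Fin 3)} {P : EuclideanSpace ℝ (Fin 3) → ℝ}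

/-! ### The `ρ'`-shaped large-scale profile data of an off-rate member -/

/-- **The profile data of a rate-`g` member in the shapes of the fictitious class `ρ' = 1/g − 2`** (crux hypotheses verbatim, `0 < ρ ≤ ½`;
`(u, p)` exactly self-similar at rate `g` with `1/(2+ρ) < g < ½`).  With `ρ' := 1/g − 2` there are a profile gradient `G` and ONE constant `c'`
such that `W`, `P`, `G` are a.e.-strongly measurable, `G` is a weak derivative of `W`, and for every `L ≥ 1`:
(A₁) `∫_{B_L}|W|² ≤ c' L^{1−2ρ'}`, (E₁) `∫_{B_L}|G|²_F ≤ L^{1−ρ'}·((1−ρ')/(2+ρ'))c'`, (D₁) `∫_{B_L}|P|^{3/2} ≤ L^{2−2ρ'}·((2−2ρ')/(2+ρ'))c'`,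
together with the weak pressure Poisson equation, the profile local energy equality WITH EXPONENT `1/(2+ρ') = g`, and the `ρ`-class one-slice
growth `∫_{B_L}|W|² ≤ 2c L^{1−2ρ}` (`L ≥ 1`) that makes the profile sub-extremal in the `ρ'`-normalisation. [folklore] -/
theorem exists_locData (hρ : 0 < ρ) (hρh : ρ ≤ 1 / 2)
    (hsw : IsSuitableWeakSolutionOn (slab (EuclideanSpace ℝ (Fin 3)) (Iio 0) isOpen_Iio) 0 0 u p)
    (hH : HasWeakSpatialGradientOn (slab (EuclideanSpace ℝ (Fin 3)) (Iio 0) isOpen_Iio) u H)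
    (hgauge : ∀ a : ℝ, 0 < a →
      ENNReal.ofReal (a ^ (2 * ρ)) * cknA a (0 : ℝ × EuclideanSpace ℝ (Fin 3)) u +
          ENNReal.ofReal (a ^ ρ) * cknE a (0 : ℝ × EuclideanSpace ℝ (Fin 3)) H +
        ENNReal.ofReal (a ^ (2 * ρ)) * cknD a (0 : ℝ × EuclideanSpace ℝ (Fin 3)) p ≤ (c : ℝ≥0∞))
    (hg1 : 1 / (2 + ρ) < g) (hg2 : g < 1 / 2)
    (hu : ∀ τ : ℝ, τ < 0 → u τ = selfSimilarCollapse g 0 W τ)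
    (hp : ∀ τ : ℝ, τ < 0 → p τ = selfSimilarCollapsePressure g 0 P τ) :
    ∃ (G : EuclideanSpace ℝ (Fin 3) → EuclideanSpace ℝ (Fin 3) →L[ℝ] EuclideanSpace ℝ (Fin 3)) (c' : ℝ≥0),
      AEStronglyMeasurable W volume ∧ AEStronglyMeasurable P volume ∧ AEStronglyMeasurable G volume ∧
      HasWeakFDerivOn (⊤ : Opens (EuclideanSpace ℝ (Fin 3))) volume W G ∧
      (∀ L : ℝ, 1 ≤ L → ∫⁻ y in ball (0 : EuclideanSpace ℝ (Fin 3)) L, ‖W y‖ₑ ^ 2 ≤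
        (c' : ℝ≥0∞) * ENNReal.ofReal (L ^ (1 - 2 * (1 / g - 2)))) ∧
      (∀ L : ℝ, 1 ≤ L →
        ∫⁻ y in ball (0 : EuclideanSpace ℝ (Fin 3)) L, ENNReal.ofReal (frobeniusNormSq (G y)) ≤
          ENNReal.ofReal (L ^ (1 - (1 / g - 2))) *
            (ENNReal.ofReal ((1 - (1 / g - 2)) / (2 + (1 / g - 2))) * (c' : ℝ≥0∞))) ∧
      (∀ L : ℝ, 1 ≤ L →
        ∫⁻ y in ball (0 : EuclideanSpace ℝ (Fin 3)) L, ‖P y‖ₑ ^ (3 / 2 : ℝ) ≤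
          ENNReal.ofReal (L ^ (2 - 2 * (1 / g - 2))) *
            (ENNReal.ofReal ((2 - 2 * (1 / g - 2)) / (2 + (1 / g - 2))) * (c' : ℝ≥0∞))) ∧
      (∀ θ : EuclideanSpace ℝ (Fin 3) → ℝ, ContDiff ℝ (⊤ : ℕ∞) θ → HasCompactSupport θ →
        ∫ y, P y * (Δ θ) y = -∫ y, fderiv ℝ (fderiv ℝ θ) y (W y) (W y)) ∧
      (∀ σ : EuclideanSpace ℝ (Fin 3) → ℝ, IsTestFunctionOn (⊤ : Opens (EuclideanSpace ℝ (Fin 3))) σ →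
        (2 - 5 * (1 / (2 + (1 / g - 2)))) * ∫ x, σ x * ‖W x‖ ^ 2 =
          (∫ x, (‖W x‖ ^ 2 + 2 * P x) * ⟪W x, gradient σ x⟫) +
            (1 / (2 + (1 / g - 2))) * ∫ x, ‖W x‖ ^ 2 * ⟪x, gradient σ x⟫) ∧
      (∀ L : ℝ, 1 ≤ L → ∫⁻ y in ball (0 : EuclideanSpace ℝ (Fin 3)) L, ‖W y‖ₑ ^ 2 ≤
        ENNReal.ofReal (2 * c) * ENNReal.ofReal (L ^ (1 - 2 * ρ))) := by
  have hρ1 : ρ < 1 := by linarith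
  obtain ⟨hρ'0, hρ'ρ, hρ'1, hginv⟩ := exponent_facts hρ hρ1 hg1 hg2
  set ρ' : ℝ := 1 / g - 2 with hρ'
  have h2ρ' : (0 : ℝ) < 2 + ρ' := by linarith
  -- the three gauges separately
  have hA : ∀ a : ℝ, 0 < a → ENNReal.ofReal (a ^ (2 * ρ)) *
      cknA a (0 : ℝ × EuclideanSpace ℝ (Fin 3)) u ≤ (c : ℝ≥0∞) :=
    fun a ha => le_trans (le_trans le_self_add le_self_add) (hgauge a ha)
  have hE : ∀ a : ℝ, 0 < a → ENNReal.ofReal (a ^ ρ) *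
      cknE a (0 : ℝ × EuclideanSpace ℝ (Fin 3)) H ≤ (c : ℝ≥0∞) :=
    fun a ha => le_trans (le_trans le_add_self le_self_add) (hgauge a ha)
  have hD : ∀ a : ℝ, 0 < a → ENNReal.ofReal (a ^ (2 * ρ)) *
      cknD a (0 : ℝ × EuclideanSpace ℝ (Fin 3)) p ≤ (c : ℝ≥0∞) :=
    fun a ha => le_trans le_add_self (hgauge a ha)
  -- ### measurability on the slab
  have hsol : IsDistributionalNSSolutionOn (slab (EuclideanSpace ℝ (Fin 3)) (Iio 0) isOpen_Iio) 0 0 u p :=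
    hsw.distributional
  have hum : AEStronglyMeasurable (uncurry u)
      (volume.restrict (Iio (0 : ℝ) ×ˢ (univ : Set (EuclideanSpace ℝ (Fin 3))))) := by
    have := hH.locallyIntegrableOn.aestronglyMeasurable
    simpa [slab] using this
  have hpm : AEStronglyMeasurable (uncurry p)
      (volume.restrict (Iio (0 : ℝ) ×ˢ (univ : Set (EuclideanSpace ℝ (Fin 3))))) := by
    have := hsol.2.2.1.aestronglyMeasurable
    simpa [slab] using this
  have hHm : AEStronglyMeasurable (uncurry H)
      (volume.restrict (Iio (0 : ℝ) ×ˢ (univ : Set (EuclideanSpace ℝ (Fin 3))))) := by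
    have := hH.locallyIntegrableOn_grad.aestronglyMeasurable
    simpa [slab] using this
  have hWm : AEStronglyMeasurable W volume := aestronglyMeasurable_profile hum hu
  have hPm : AEStronglyMeasurable P volume := aestronglyMeasurable_pressureProfile hpm hp
  -- ### the profile gradient (rate `g`)
  obtain ⟨G, hGm, hWG, hHae⟩ := exists_profileGradient_ae hH hu
  -- ### the truncated gradient and pressure: `ρ'`-gauges at every scale, representation on `τ < −1`
  set H' : ℝ → EuclideanSpace ℝ (Fin 3) → EuclideanSpace ℝ (Fin 3) →L[ℝ] EuclideanSpace ℝ (Fin 3) :=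
    fun τ x => if τ < -1 then H τ x else 0 with hH'
  set p' : ℝ → EuclideanSpace ℝ (Fin 3) → ℝ := fun τ x => if τ < -1 then p τ x else 0 with hp'def
  have hH'm : AEStronglyMeasurable (uncurry H')
      (volume.restrict (Iio (0 : ℝ) ×ˢ (univ : Set (EuclideanSpace ℝ (Fin 3))))) :=
    aestronglyMeasurable_uncurry_cut hHm (-1)
  have hp'm : AEStronglyMeasurable (uncurry p')
      (volume.restrict (Iio (0 : ℝ) ×ˢ (univ : Set (EuclideanSpace ℝ (Fin 3))))) :=
    aestronglyMeasurable_uncurry_cut hpm (-1)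
  have hE' : ∀ a : ℝ, 0 < a → ENNReal.ofReal (a ^ ρ') *
      cknE a (0 : ℝ × EuclideanSpace ℝ (Fin 3)) H' ≤ (c : ℝ≥0∞) := gaugeE_cut hρ'ρ.le hE le_rfl
  have hD' : ∀ a : ℝ, 0 < a → ENNReal.ofReal (a ^ (2 * ρ')) *
      cknD a (0 : ℝ × EuclideanSpace ℝ (Fin 3)) p' ≤ (c : ℝ≥0∞) := gaugeD_cut hρ'ρ.le hD le_rfl
  have hH'ae : ∀ᵐ τ ∂((volume : Measure ℝ).restrict (Iio (-1 : ℝ))),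
      H' τ =ᵐ[volume] fun x => ((0 : ℝ) - τ) ^ (-1 : ℝ) • G (((0 : ℝ) - τ) ^ (-(1 / (2 + ρ'))) • (x - 0)) := by
    have h1 : ∀ᵐ τ ∂((volume : Measure ℝ).restrict (Iio (-1 : ℝ))),
        H τ =ᵐ[volume] fun x => (-τ) ^ (-1 : ℝ) • G ((-τ) ^ (-g) • x) :=
      ae_restrict_of_ae_restrict_of_subset (Iio_subset_Iio (by norm_num)) hHae
    filter_upwards [h1, ae_restrict_mem measurableSet_Iio] with τ hτ hτ1
    have hτ1' : τ < -1 := hτ1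
    have hH'τ : H' τ = H τ := by funext x; simp [hH', hτ1']
    rw [hH'τ]
    refine hτ.trans (Eventually.of_forall fun x => ?_)
    simp only [zero_sub, sub_zero, hginv]
  have hp'rep : ∀ τ : ℝ, τ < -1 → p' τ = fun x => selfSimilarCollapsePressure (1 / (2 + ρ')) 0 P τ (x - 0) := by
    intro τ hτ
    funext x
    have : p' τ x = p τ x := by simp [hp'def, hτ]
    rw [this, hp τ (by linarith), sub_zero, hginv]
  -- ### the large-scale gauge data: one slice (A), the bricks with `ρ'` (E, D)
  have hgrowthA := profile_growth_ge_one hρ.le hA hu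
  obtain ⟨CE, hCE, hE''⟩ :=
    Past.profile_gradient_growth_of_gaugeE_past hρ'0 hρ'1 (T := 0) (T₁ := -1) (by norm_num) (by norm_num) 0 hH'm hH'ae hE'
  obtain ⟨CD, hCD, hD''⟩ :=
    Past.profile_pressure_growth_of_gaugeD_past hρ'0 hρ'1 (T := 0) (T₁ := -1) (by norm_num) (by norm_num) 0 hp'm hp'rep hD'
  -- ### integrability on all balls
  have hA0 : ∀ L : ℝ, 1 ≤ L → ∫⁻ y in ball (0 : EuclideanSpace ℝ (Fin 3)) L, ‖W y‖ₑ ^ 2 ≤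
      ENNReal.ofReal (2 * c) * ENNReal.ofReal (L ^ (1 - 2 * ρ)) := hgrowthA
  have hV2fin : ∀ r : ℝ, ∫⁻ y in ball (0 : EuclideanSpace ℝ (Fin 3)) r, ‖W y‖ₑ ^ 2 < ⊤ :=
    Past.lintegral_ball_lt_top_of_growth ENNReal.ofReal_ne_top hA0
  have hGfin : ∀ r : ℝ, ∫⁻ y in ball (0 : EuclideanSpace ℝ (Fin 3)) r, ENNReal.ofReal (frobeniusNormSq (G y)) < ⊤ :=
    Past.lintegral_ball_lt_top_of_growth hCE hE''
  have hPfin : ∀ r : ℝ, ∫⁻ y in ball (0 : EuclideanSpace ℝ (Fin 3)) r, ‖P y‖ₑ ^ (3 / 2 : ℝ) < ⊤ :=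
    Past.lintegral_ball_lt_top_of_growth hCD hD''
  have hV2R : ∀ r : ℝ, MemLp W 2 (volume.restrict (ball (0 : EuclideanSpace ℝ (Fin 3)) r)) :=
    Past.memLp_two_ball_of_lintegral_lt_top hWm hV2fin
  have hG2R : ∀ r : ℝ, MemLp G 2 (volume.restrict (ball (0 : EuclideanSpace ℝ (Fin 3)) r)) :=
    Past.memLp_two_ball_gradient_of_lintegral_lt_top hGm hGfin
  have hP32R : ∀ r : ℝ, MemLp P (3 / 2 : ℝ≥0∞) (volume.restrict (ball (0 : EuclideanSpace ℝ (Fin 3)) r)) :=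
    Past.memLp_threeHalves_ball_of_lintegral_lt_top hPm hPfin
  have hV6R : ∀ r : ℝ, MemLp W 6 (volume.restrict (ball (0 : EuclideanSpace ℝ (Fin 3)) r)) :=
    Past.memLp_six_ball_of_gradient hWm hWG hV2R hGfin
  -- ### local integrability of `W`, `|W|²`, `P`
  have hVloc : LocallyIntegrable W volume := locallyIntegrableOn_univ.1 (by
    simpa only [Opens.coe_top] using hWG.locallyIntegrableOn)
  have hV2loc : LocallyIntegrable (fun y => ‖W y‖ ^ 2) volume := by
    refine (locallyIntegrable_iff).2 fun K hK => ?_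
    obtain ⟨r, hr⟩ := hK.isBounded.subset_ball (0 : EuclideanSpace ℝ (Fin 3))
    have h := (hV2R r).integrable_norm_pow two_ne_zero
    exact IntegrableOn.mono_set (show IntegrableOn (fun y => ‖W y‖ ^ 2) (ball 0 r) volume from h) hr
  have hPloc : LocallyIntegrable P volume := by
    refine (locallyIntegrable_iff).2 fun K hK => ?_
    obtain ⟨r, hr⟩ := hK.isBounded.subset_ball (0 : EuclideanSpace ℝ (Fin 3))
    haveI : IsFiniteMeasure ((volume : Measure (EuclideanSpace ℝ (Fin 3))).restrict
        (ball (0 : EuclideanSpace ℝ (Fin 3)) r)) :=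
      isFiniteMeasure_restrict.2 measure_ball_lt_top.ne
    have h : IntegrableOn P (ball (0 : EuclideanSpace ℝ (Fin 3)) r) volume :=
      memLp_one_iff_integrable.1 ((hP32R r).mono_exponent (by
        rw [ENNReal.le_div_iff_mul_le (Or.inl (by norm_num)) (Or.inl (by norm_num))]; norm_num))
    exact h.mono_set hr
  -- ### the equations at rate `g`, read in the `ρ'`-shape
  have heq := fun (ψ : EuclideanSpace ℝ (Fin 3) → EuclideanSpace ℝ (Fin 3))
      (hψ : IsTestFunctionOn (⊤ : Opens (EuclideanSpace ℝ (Fin 3))) ψ) =>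
    ProfileEquation.weak_profile_equation hsol hu hp hVloc hV2loc hPloc hψ
  have hdiv : IsWeaklyDivFree W := ProfileEquation.profile_isWeaklyDivFree hsol hu hVloc
  have hPoisson : ∀ θ : EuclideanSpace ℝ (Fin 3) → ℝ, ContDiff ℝ (⊤ : ℕ∞) θ → HasCompactSupport θ →
      ∫ y, P y * (Δ θ) y = -∫ y, fderiv ℝ (fderiv ℝ θ) y (W y) (W y) :=
    fun θ hθ hθc => Past.profile_pressure_poisson_of_distributional hsol hum hu hp hV2loc hPloc hθ hθc
  have hEEg := fun (σ : EuclideanSpace ℝ (Fin 3) → ℝ)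
      (hσ : IsTestFunctionOn (⊤ : Opens (EuclideanSpace ℝ (Fin 3))) σ) =>
    ProfileEnergy.profile_local_energy_equality hWG hV6R hG2R hPm hP32R hdiv heq hσ
  have hEE : ∀ σ : EuclideanSpace ℝ (Fin 3) → ℝ, IsTestFunctionOn (⊤ : Opens (EuclideanSpace ℝ (Fin 3))) σ →
      (2 - 5 * (1 / (2 + ρ'))) * ∫ x, σ x * ‖W x‖ ^ 2 =
        (∫ x, (‖W x‖ ^ 2 + 2 * P x) * ⟪W x, gradient σ x⟫) +
          (1 / (2 + ρ')) * ∫ x, ‖W x‖ ^ 2 * ⟪x, gradient σ x⟫ := by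
    intro σ hσ
    rw [hginv]
    exact hEEg σ hσ
  -- ### thresholds to `L ≥ 1` and ONE common constant in the shapes (A₁), (E₁), (D₁)
  -- adapted from `Past.exists_locData_of_past` (…SelfSimilarPastSubExtremal)
  have hL₀ : (1 : ℝ) ≤ 2 - (-1 : ℝ) := by norm_num
  have hE1 := Past.growth_ge_one_of_growth_ge hL₀ (by linarith : (0 : ℝ) ≤ 1 - ρ') hE''
  have hD1 := Past.growth_ge_one_of_growth_ge hL₀ (by linarith : (0 : ℝ) ≤ 2 - 2 * ρ') hD''
  -- (A₁) in the `ρ'`-exponent: `L^{1−2ρ} ≤ L^{1−2ρ'}` for `L ≥ 1`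
  have hA1 : ∀ L : ℝ, 1 ≤ L → ∫⁻ y in ball (0 : EuclideanSpace ℝ (Fin 3)) L, ‖W y‖ₑ ^ 2 ≤
      ENNReal.ofReal (2 * c) * ENNReal.ofReal (L ^ (1 - 2 * ρ')) := by
    intro L hL
    refine (hA0 L hL).trans (mul_le_mul_right (ENNReal.ofReal_le_ofReal ?_) _)
    exact Real.rpow_le_rpow_of_exponent_le hL (by linarith)
  set CA' : ℝ≥0∞ := ENNReal.ofReal (2 * c) with hCA'
  set CE' : ℝ≥0∞ := CE * ENNReal.ofReal ((2 - (-1 : ℝ)) ^ (1 - ρ')) with hCE'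
  set CD' : ℝ≥0∞ := CD * ENNReal.ofReal ((2 - (-1 : ℝ)) ^ (2 - 2 * ρ')) with hCD'
  have hCA't : CA' ≠ ⊤ := ENNReal.ofReal_ne_top
  have hCE't : CE' ≠ ⊤ := ENNReal.mul_ne_top hCE ENNReal.ofReal_ne_top
  have hCD't : CD' ≠ ⊤ := ENNReal.mul_ne_top hCD ENNReal.ofReal_ne_top
  set κE : ℝ := (1 - ρ') / (2 + ρ') with hκE
  set κD : ℝ := (2 - 2 * ρ') / (2 + ρ') with hκD
  have hκE0 : 0 < κE := by rw [hκE]; exact div_pos (by linarith) h2ρ'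
  have hκD0 : 0 < κD := by rw [hκD]; exact div_pos (by linarith) h2ρ'
  set a : ℝ := CA'.toReal with ha
  set e : ℝ := CE'.toReal with he
  set d : ℝ := CD'.toReal with hd
  have ha0 : 0 ≤ a := ENNReal.toReal_nonneg
  have he0 : 0 ≤ e := ENNReal.toReal_nonneg
  have hd0 : 0 ≤ d := ENNReal.toReal_nonneg
  set c₀ : ℝ := a + e / κE + d / κD with hc₀
  have hc₀0 : 0 ≤ c₀ := by positivity
  set c' : ℝ≥0 := c₀.toNNReal with hc'
  have hcc : (c' : ℝ≥0∞) = ENNReal.ofReal c₀ := rfl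
  have haC : CA' = ENNReal.ofReal a := (ENNReal.ofReal_toReal hCA't).symm
  have heC : CE' = ENNReal.ofReal e := (ENNReal.ofReal_toReal hCE't).symm
  have hdC : CD' = ENNReal.ofReal d := (ENNReal.ofReal_toReal hCD't).symm
  have hAle : CA' ≤ (c' : ℝ≥0∞) := by
    rw [haC, hcc]
    refine ENNReal.ofReal_le_ofReal ?_
    have : 0 ≤ e / κE + d / κD := by positivity
    rw [hc₀]; linarith
  have hEle : CE' ≤ ENNReal.ofReal κE * (c' : ℝ≥0∞) := by
    rw [heC, hcc, ← ENNReal.ofReal_mul hκE0.le]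
    refine ENNReal.ofReal_le_ofReal ?_
    have h1 : κE * (e / κE) = e := mul_div_cancel₀ e hκE0.ne'
    have h2 : 0 ≤ κE * a + κE * (d / κD) := by positivity
    rw [hc₀]; nlinarith [h1, h2]
  have hDle : CD' ≤ ENNReal.ofReal κD * (c' : ℝ≥0∞) := by
    rw [hdC, hcc, ← ENNReal.ofReal_mul hκD0.le]
    refine ENNReal.ofReal_le_ofReal ?_
    have h1 : κD * (d / κD) = d := mul_div_cancel₀ d hκD0.ne'
    have h2 : 0 ≤ κD * a + κD * (e / κE) := by positivity
    rw [hc₀]; nlinarith [h1, h2]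
  refine ⟨G, c', hWm, hPm, hGm, hWG, fun L hL => (hA1 L hL).trans (mul_le_mul' hAle le_rfl),
    fun L hL => (hE1 L hL).trans ?_, fun L hL => (hD1 L hL).trans ?_, hPoisson, hEE, hA0⟩
  · rw [mul_comm]; exact mul_le_mul' le_rfl hEle
  · rw [mul_comm]; exact mul_le_mul' le_rfl hDle

/-! ### Rate rigidity -/

/-- **OFF-RATE SELF-SIMILAR MEMBERS IN THE WINDOW ARE TRIVIAL.**  Crux hypotheses verbatim (`0 < ρ ≤ ½`; suitable weak Euler pair, weak gradient,
the three power gauges) + `u(τ) = selfSimilarCollapse g 0 W τ`, `p(τ) = selfSimilarCollapsePressure g 0 P τ` for all `τ < 0` with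
`1/(2+ρ) < g < ½` ⇒ `u = 0` a.e. on `(−∞, 0) × ℝ³` — NO hypothesis on the profile.  (`OffRate.exists_locData` + the automatic sub-extremality
`L^{2ρ'−1}∫_{B_L}|W|² ≤ 2c L^{2(ρ'−ρ)} → 0` + `EnergySaturation.ae_eq_zero_of_subExtremal_loc (ρ := 1/g − 2)` + `Past.ae_eq_zero_of_profile_ae_eq_zero`.)
[folklore; cf. BronziShvydkoy2015 Thm 1.1] -/
theorem selfSimilar_ae_eq_zero_of_rate_window (hρ : 0 < ρ) (hρh : ρ ≤ 1 / 2)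
    (hsw : IsSuitableWeakSolutionOn (slab (EuclideanSpace ℝ (Fin 3)) (Iio 0) isOpen_Iio) 0 0 u p)
    (hH : HasWeakSpatialGradientOn (slab (EuclideanSpace ℝ (Fin 3)) (Iio 0) isOpen_Iio) u H)
    (hgauge : ∀ a : ℝ, 0 < a →
      ENNReal.ofReal (a ^ (2 * ρ)) * cknA a (0 : ℝ × EuclideanSpace ℝ (Fin 3)) u +
          ENNReal.ofReal (a ^ ρ) * cknE a (0 : ℝ × EuclideanSpace ℝ (Fin 3)) H +
        ENNReal.ofReal (a ^ (2 * ρ)) * cknD a (0 : ℝ × EuclideanSpace ℝ (Fin 3)) p ≤ (c : ℝ≥0∞))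
    (hg1 : 1 / (2 + ρ) < g) (hg2 : g < 1 / 2)
    (hu : ∀ τ : ℝ, τ < 0 → u τ = selfSimilarCollapse g 0 W τ)
    (hp : ∀ τ : ℝ, τ < 0 → p τ = selfSimilarCollapsePressure g 0 P τ) :
    uncurry u =ᵐ[volume.restrict (Iio (0 : ℝ) ×ˢ (univ : Set (EuclideanSpace ℝ (Fin 3))))] 0 := by
  have hρ1 : ρ < 1 := by linarith
  obtain ⟨hρ'0, hρ'ρ, hρ'1, -⟩ := exponent_facts hρ hρ1 hg1 hg2
  obtain ⟨G, c', hWm, hPm, hGm, hWG, hA₁, hE₁, hD₁, hPoisson, hEE, hA0⟩ :=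
    exists_locData hρ hρh hsw hH hgauge hg1 hg2 hu hp
  -- ### sub-extremality in the `ρ'`-normalisation is automatic
  have hsub : ∀ ε : ℝ, 0 < ε → ∀ L₀ : ℝ, ∃ L : ℝ, L₀ ≤ L ∧
      L ^ (2 * (1 / g - 2) - 1) * ∫ y in ball (0 : EuclideanSpace ℝ (Fin 3)) L, ‖W y‖ ^ 2 < ε := by
    intro ε hε L₀
    have hc0 : (0 : ℝ) ≤ c := c.2
    -- `2c L^{2(ρ'−ρ)} → 0`
    have htend : Tendsto (fun L : ℝ => L ^ (-(2 * (ρ - (1 / g - 2)))) * (2 * c)) atTop (𝓝 (0 * (2 * c))) :=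
      (tendsto_rpow_neg_atTop (by linarith)).mul_const _
    rw [zero_mul] at htend
    obtain ⟨L, hLε, hLge⟩ := ((htend.eventually (gt_mem_nhds hε)).and (eventually_ge_atTop (max L₀ 1))).exists
    have hL1 : 1 ≤ L := (le_max_right _ _).trans hLge
    have hL0 : 0 < L := by linarith
    refine ⟨L, (le_max_left _ _).trans hLge, lt_of_le_of_lt ?_ hLε⟩
    -- the Bochner ball bound from the one-slice growth
    have hball : ∫ y in ball (0 : EuclideanSpace ℝ (Fin 3)) L, ‖W y‖ ^ 2 ≤ 2 * c * L ^ (1 - 2 * ρ) := by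
      refine integral_ball_norm_sq_le hWm (by positivity) ?_
      rw [ENNReal.ofReal_mul (by positivity)]
      exact hA0 L hL1
    calc L ^ (2 * (1 / g - 2) - 1) * ∫ y in ball (0 : EuclideanSpace ℝ (Fin 3)) L, ‖W y‖ ^ 2
        ≤ L ^ (2 * (1 / g - 2) - 1) * (2 * c * L ^ (1 - 2 * ρ)) :=
          mul_le_mul_of_nonneg_left hball (Real.rpow_nonneg hL0.le _)
      _ = L ^ (-(2 * (ρ - (1 / g - 2)))) * (2 * c) := by
          rw [show L ^ (2 * (1 / g - 2) - 1) * (2 * c * L ^ (1 - 2 * ρ)) =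
              L ^ (2 * (1 / g - 2) - 1) * L ^ (1 - 2 * ρ) * (2 * c) by ring, ← Real.rpow_add hL0]
          congr 2
          ring
  have hW0 : W =ᵐ[volume] 0 :=
    EnergySaturation.ae_eq_zero_of_subExtremal_loc hρ'0 hρ'1 hWm hPm hGm hWG hA₁ hE₁ hD₁ hPoisson hEE hsub
  have hu' : ∀ τ : ℝ, τ < 0 → u τ = fun x => selfSimilarCollapse g 0 W τ (x - 0) := fun τ hτ => by
    rw [hu τ hτ]; funext x; rw [sub_zero]
  exact Past.ae_eq_zero_of_profile_ae_eq_zero (T := 0) (T₁ := 0) hρ.le le_rfl hsw hH hgauge hu' hW0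

/-- **RATE RIGIDITY: AN EXACTLY SELF-SIMILAR MEMBER OF THE CLASS COLLAPSING AT ANY RATE `g ≠ 1/(2+ρ)` IS TRIVIAL** (crux hypotheses verbatim,
`0 < ρ ≤ ½`; weak class, no profile hypothesis): `u(τ) = selfSimilarCollapse g 0 W τ`, `p(τ) = selfSimilarCollapsePressure g 0 P τ` (`τ < 0`), `g ≠ γ`
⇒ `u = 0` a.e.  Slow rates `g < γ`: `PastShape.ae_eq_zero_of_gauge_of_slowPowerClock` (the `A`-gauge at `τ → 0⁻`); the window `γ < g < ½`:
`selfSimilar_ae_eq_zero_of_rate_window`; rates `g ≥ ½ > ½ − ρ/5`: `PastShape.ae_eq_zero_of_gauge_of_pastFastPowerClock` (the `A`-gauge at `τ → −∞`).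
So in Seregin's power-gauged class an exactly self-similar ancient Euler flow must collapse at the class rate — the residue is THE ONE STATEMENT
(`g = γ`) and nothing else. [folklore; cf. BronziShvydkoy2015 Thm 1.1] -/
theorem selfSimilar_ae_eq_zero_of_rate_ne (hρ : 0 < ρ) (hρh : ρ ≤ 1 / 2)
    (hsw : IsSuitableWeakSolutionOn (slab (EuclideanSpace ℝ (Fin 3)) (Iio 0) isOpen_Iio) 0 0 u p)
    (hH : HasWeakSpatialGradientOn (slab (EuclideanSpace ℝ (Fin 3)) (Iio 0) isOpen_Iio) u H)
    (hgauge : ∀ a : ℝ, 0 < a →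
      ENNReal.ofReal (a ^ (2 * ρ)) * cknA a (0 : ℝ × EuclideanSpace ℝ (Fin 3)) u +
          ENNReal.ofReal (a ^ ρ) * cknE a (0 : ℝ × EuclideanSpace ℝ (Fin 3)) H +
        ENNReal.ofReal (a ^ (2 * ρ)) * cknD a (0 : ℝ × EuclideanSpace ℝ (Fin 3)) p ≤ (c : ℝ≥0∞))
    (hg : g ≠ 1 / (2 + ρ))
    (hu : ∀ τ : ℝ, τ < 0 → u τ = selfSimilarCollapse g 0 W τ)
    (hp : ∀ τ : ℝ, τ < 0 → p τ = selfSimilarCollapsePressure g 0 P τ) :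
    uncurry u =ᵐ[volume.restrict (Iio (0 : ℝ) ×ˢ (univ : Set (EuclideanSpace ℝ (Fin 3))))] 0 := by
  -- the pointwise clock form of the ansatz
  have hclock : ∀ τ : ℝ, τ < 0 → ∀ y : EuclideanSpace ℝ (Fin 3),
      u τ y = (0 - τ) ^ (g - 1) • W ((0 - τ) ^ (-g) • y) := fun τ hτ y => by
    rw [hu τ hτ, selfSimilarCollapse_apply]
  rcases lt_or_gt_of_ne hg with hslow | hgt
  · exact PastShape.ae_eq_zero_of_gauge_of_slowPowerClock hρ hρh hsw hH hgauge hslow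
      (fun τ hτ y => by rw [hclock τ hτ y, zero_sub])
  · rcases lt_or_ge g (1 / 2) with hwin | hfast
    · exact selfSimilar_ae_eq_zero_of_rate_window hρ hρh hsw hH hgauge hgt hwin hu hp
    · exact PastShape.ae_eq_zero_of_gauge_of_pastFastPowerClock hρ hρh hsw hH hgauge (T₁ := 0) (T₀ := 0) le_rfl le_rfl
        (by linarith) hclock

end OffRate

end Summit.NavierStokesRegularity.NavierStokesRegularity.Theorems.PowerGaugeEulerLiouville

end
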